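import Mathlib

/-!
# AtomicCalibrationR (stmt-QuantumFields-28169), E2 `stub_offDiagonalWhitney` — a smooth `ℤ`-periodic partition of unity on `ℝ`
# (Plan A, step 3 ingredient `exists_smooth_periodic_partition` of planner ym-idea-11 g15's `STUB-PLAN-offDiagonalWhitney.md`)

Prover w4 g22 (free hands).  The reference one-dimensional partition of unity from which the plan builds its product grid bumps:
a `C^∞` function `φ ≥ 0` supported in `[-1, 1]` whose integer translates sum to `1` everywhere.  Construction (telescoping, no
normalisation needed): `φ(t) = H(t + 1/2) − H(t − 1/2)` with `H = Real.smoothTransition`-based smooth monotone step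
(`H = 0` on `(-∞, -1/2]`, `H = 1` on `[1/2, ∞)`); the sum over `c ∈ ℤ` of `φ(t − c)` has exactly the three possibly non-zero terms
`c ∈ {⌊t⌋-1, ⌊t⌋, ⌊t⌋+1}` and telescopes to `H(· ≥ 3/2) − H(· ≤ -1/2) = 1 − 0`.
NOTE on the plan's signature: it asks for `ContDiff ℝ ⊤ φ`; in current Mathlib `⊤ : WithTop ℕ∞` is ANALYTIC, impossible for a
non-zero compactly supported function — the correct (and sufficient) smoothness is `ContDiff ℝ ∞`, proved here.
Def-free, Mathlib only.  No stub/crux/rung/summit is closed; nothing here touches Yang–Mills; the YM mass gap is NOT proved. [folklore]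
-/

set_option autoImplicit false

noncomputable section

open scoped ContDiff
open Set

namespace Summit.QuantumFields.YangMills.Cruxes.AtomicCalibrationR.PeriodicPartition

/-- **A smooth `ℤ`-periodic partition of unity on `ℝ`**: `φ ∈ C^∞`, `0 ≤ φ`, `tsupport φ ⊆ [-1, 1]`, `Σ_{c ∈ ℤ} φ(t − c) = 1`.
[folklore] -/
theorem exists_smooth_periodic_partition :
    ∃ φ : ℝ → ℝ, ContDiff ℝ ∞ φ ∧ tsupport φ ⊆ Icc (-1) 1 ∧ (∀ t, 0 ≤ φ t) ∧ ∀ t, ∑' c : ℤ, φ (t - c) = 1 := by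
  -- the smooth monotone step `H`: `0` on `t ≤ -1/2`, `1` on `1/2 ≤ t`
  set H : ℝ → ℝ := fun t => Real.smoothTransition (t + 1 / 2) with hH
  have hHd : ContDiff ℝ ∞ H := Real.smoothTransition.contDiff.comp (contDiff_id.add contDiff_const)
  have hHmono : Monotone H := fun a b hab => Real.smoothTransition.monotone (by linarith)
  have hH0 : ∀ t, t ≤ -(1 / 2) → H t = 0 := fun t ht => Real.smoothTransition.zero_of_nonpos (by linarith)
  have hH1 : ∀ t, 1 / 2 ≤ t → H t = 1 := fun t ht => Real.smoothTransition.one_of_one_le (by linarith)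
  set φ : ℝ → ℝ := fun t => H (t + 1 / 2) - H (t - 1 / 2) with hφ
  -- `φ` vanishes outside `(-1, 1)`
  have hφ0 : ∀ t, (t ≤ -1 ∨ 1 ≤ t) → φ t = 0 := by
    rintro t (ht | ht)
    · simp only [hφ]; rw [hH0 _ (by linarith), hH0 _ (by linarith), sub_zero]
    · simp only [hφ]; rw [hH1 _ (by linarith), hH1 _ (by linarith), sub_self]
  refine ⟨φ, ?_, ?_, ?_, ?_⟩
  · exact (hHd.comp (contDiff_id.add contDiff_const)).sub (hHd.comp (contDiff_id.sub contDiff_const))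
  · -- support
    refine closure_minimal (fun t ht => ?_) isClosed_Icc
    rw [Function.mem_support] at ht
    rw [mem_Icc]
    by_contra hcon
    rw [not_and_or, not_le, not_le] at hcon
    rcases hcon with h | h
    · exact ht (hφ0 t (Or.inl h.le))
    · exact ht (hφ0 t (Or.inr h.le))
  · intro t
    simp only [hφ, sub_nonneg]
    exact hHmono (by linarith)
  · intro t
    -- only `c ∈ {⌊t⌋ - 1, ⌊t⌋, ⌊t⌋ + 1}` contribute
    set k : ℤ := ⌊t⌋ with hk
    have hk1 : (k : ℝ) ≤ t := Int.floor_le t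
    have hk2 : t < (k : ℝ) + 1 := Int.lt_floor_add_one t
    have hzero : ∀ c : ℤ, c ∉ ({k - 1, k, k + 1} : Finset ℤ) → φ (t - c) = 0 := by
      intro c hc
      simp only [Finset.mem_insert, Finset.mem_singleton, not_or] at hc
      obtain ⟨hc1, hc2, hc3⟩ := hc
      rcases lt_or_gt_of_ne hc2 with hlt | hgt
      · -- `c ≤ k - 2`
        have hc' : c ≤ k - 2 := by omega
        have : (c : ℝ) ≤ (k : ℝ) - 2 := by exact_mod_cast hc'
        exact hφ0 _ (Or.inr (by linarith))
      · have hc' : k + 2 ≤ c := by omega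
        have : (k : ℝ) + 2 ≤ (c : ℝ) := by exact_mod_cast hc'
        exact hφ0 _ (Or.inl (by linarith))
    rw [tsum_eq_sum (s := ({k - 1, k, k + 1} : Finset ℤ)) (fun c hc => hzero c hc)]
    have hne1 : k - 1 ≠ k := by omega
    have hne2 : k - 1 ≠ k + 1 := by omega
    have hne3 : k ≠ k + 1 := by omega
    rw [Finset.sum_insert (by simp [hne1, hne2]), Finset.sum_pair hne3]
    simp only [hφ]
    push_cast
    -- telescoping: ends at `H(t - k + 3/2) = 1` and `H(t - k - 3/2) = 0`
    have e1 : H (t - (k - 1) + 1 / 2) = 1 := hH1 _ (by linarith)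
    have e2 : H (t - (k + 1) - 1 / 2) = 0 := hH0 _ (by linarith)
    have e3 : t - ((k : ℝ) - 1) - 1 / 2 = t - k + 1 / 2 := by ring
    have e4 : t - ((k : ℝ) + 1) + 1 / 2 = t - k - 1 / 2 := by ring
    rw [e1, e2, e3, e4]
    ring

end Summit.QuantumFields.YangMills.Cruxes.AtomicCalibrationR.PeriodicPartition

end
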